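import Summits.ABC.IUTFork.Repair.CandInternal2RealStrata
import HarnessLib

/-!
# IUT REPAIR branch → R-H (D-0079 «local-height» programme): the LABEL-CUT (C1) k2 TEMPLATE, ARITHMETIC HALF —
# `((j:ℝ)² − 1)·H ≤ 2l·κ ⟺ j ≤ ⌊√(1 + 2l·κ/H)⌋₊`, and the below-cut I06⋆ cells DECIDED at a genuine local field

PROOF-ONLY companion (D-0012: 0 definitions, 0 `Prop` facts, no instance, no notation; abc-iut cell, rung LADDER-ABC:A2.RP → A2.RESCUE-H;
seat abc-iut-rp-h3 gen 5) of `CandInternal11GapLabelCut` (the set / volume / S_H halves of the label-cut template over the lattice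
vocabulary). THIS file carries only the `p`-adic side (imports abc-iut-rp-d2's `CandInternal2RealStrata` ⊇ `CandInternal2RealLabels`, p451037 /
p450037, consumed BY NAME: `jsq_root_window`, `lowerEdge_two`, `pstarExp_of_ne_two`; abc-iut-S1's [IUTchIV] Prop. 1.2 exponents
`Literature.IUT.LogVolume.logRadiusA` / `logRadiusB`). TAKES NO SIDE on [IUTchIII] Cor. 3.12 or on any author; RP-I06⋆ and its cells are
abc-iut-rp-d2's CANDIDATE READING; typed ≠ proved; instantiated ≠ endorsed. Inputs ⊆ the frozen FACT-LIST; standard axioms.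

NOTATION (abc-iut-rh-lead START-HERE v1 §1, per cell (datum, bad place `w | p`, label `j`)): `H := ord_p(q_E)` at the place below `w`, so the
intended Kummer datum `q̲_w` (a `2l`-th root of `q_v`) has `‖q̲_w‖^{2l} = p^{−H}`; demand `h(w,j) := (j²−1)·H/(2l)`; `c := ord_p(p*)`;
`κ⁻(w) := c − a_e` (SUFFICIENT exponent, `pBall_logRadiusA_subset_logUnits`), `κ⁺(w) := b_e + c` (NECESSARY exponent).

* §4 ARITHMETIC OF THE CUT (reals): **`jsq_sub_one_mul_le_iff_le_floor_sqrt`** — for `0 < H`, `0 ≤ κ`: `((j:ℝ)² − 1)·H ≤ 2l·κ ⟺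
  j ≤ ⌊√(1 + 2l·κ/H)⌋₊`; so START-HERE §4 (C1)'s cut `j₀(w) := ⌊√(1 + 2l·κ⁻(w)/H)⌋` is EXACTLY «the labels whose cell is DECIDED-POS by the
  sufficient radius», and `⌊√(1 + 2l·κ⁺(w)/H)⌋` bounds every label I06⋆ can hold at; `natCast_…` (the same with abc-iut-rp-d2's `ℕ`-casts);
  `floor_sqrt_mono_kappa` / `floor_sqrt_anti_height` (the cut grows with the shell exponent and shrinks with the local height);
  `one_le_floor_sqrt` (the label `1` never binds); `logRadiusA_le_one`, **`lowerEdge_nonneg`** (`0 ≤ c − a_e` at EVERY prime: the sufficient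
  exponent is a legitimate `κ`), `lowerCut_le_upperCut`.
* §5 GENUINE LOCAL FIELD (`K ⊇ ℚ_p` complete, `q̲ ≠ 0`, `‖q̲‖^{2l} = p^{−H}`, `H > 0`): **`mem_pow_smul_logShell_of_le_labelCut`** — `∀ j ≤
  ⌊√(1 + 2l·(c − a_e)/H)⌋₊, q̲ ∈ q̲^{j²}·ℐ_K` (the below-cut cells are DECIDED-POS BY NAME: abc-iut-rp-d2's `jsq_root_window`, sufficient leg);
  **`le_upperCut_of_mem_pow_smul_logShell`** — `q̲ ∈ q̲^{j²}·ℐ_K ⟹ j ≤ ⌊√(1 + 2l·(b_e + c)/H)⌋₊` (necessary leg): a label-cut candidate whose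
  cut exceeds the upper threshold at some tabled place is KILLED (k1) by name; one whose cut is `≤ j₀(w)` everywhere has its I06⋆ half TRUE
  at genuine data and owes only the above-cut budget of `CandInternal11GapLabelCut` §2–§3.

IDENTITY for the I06STAR-COLUMNS join (abc-iut-rp-d2 14:56:07Z, `h = (j²−1)·H/(2l)`): `slack_minus(w,j) ≥ 0 ⟺ j ≤ ⌊√(1 + 2l·kappa_minus/H)⌋`
and `slack_plus(w,j) < 0 ⟺ ⌊√(1 + 2l·kappa_plus/H)⌋ < j` — §4 read at `κ := kappa_minus`, `kappa_plus`.

HONEST SCOPE. Classical `p`-adic analysis at ONE local field plus real arithmetic; nothing about initial Θ-data, hulls or volumes (those are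
the other half's hypotheses). [cite: MochizukiAbsTopIII2015, Def 5.4 (iii) p. 126] [claim: Mochizuki2012, status: disputed] for the [IUTchIV]
Prop. 1.2 exponents and every IUT locution. Axioms: standard.
-/

noncomputable section

namespace Summit.ABC.IUTFork.Repair.CandInternal11GapLabelCutArith

open Set Metric
open scoped Pointwise
open Literature.AnabelianGeometry.AbsoluteAnabelian Literature.IUT.LogThetaLattice Literature.IUT.LogVolume
  Summit.ABC.IUTFork.Repair.CandInternal2Real Summit.ABC.IUTFork.Repair.CandInternal2RealLabels
  Summit.ABC.IUTFork.Repair.CandInternal2RealStrata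

/-! ## §4. Arithmetic of the cut: `((j:ℝ)² − 1)·H ≤ 2l·κ ⟺ j ≤ ⌊√(1 + 2l·κ/H)⌋₊` -/

section Arithmetic

/-- **THE LABEL CUT IN CLOSED FORM.** For a local height `H > 0` (`‖q̲‖^{2l} = p^{−H}`) and a shell exponent `κ ≥ 0`: the cell inequality
`((j:ℝ)² − 1)·H ≤ 2l·κ` (demand `h = (j²−1)H/(2l) ≤ κ`) holds iff `j ≤ ⌊√(1 + 2l·κ/H)⌋₊`. With `κ := c − a_e` this is START-HERE §4 (C1)'s
`j₀(w)`; with `κ := b_e + c` it is the necessary threshold. [folklore] -/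
theorem jsq_sub_one_mul_le_iff_le_floor_sqrt {H κ : ℝ} (hH : 0 < H) (hκ : 0 ≤ κ) (l j : ℕ) :
    ((j : ℝ) ^ 2 - 1) * H ≤ 2 * (l : ℝ) * κ ↔ j ≤ ⌊Real.sqrt (1 + 2 * (l : ℝ) * κ / H)⌋₊ := by
  have hy : (0 : ℝ) ≤ 1 + 2 * (l : ℝ) * κ / H := by positivity
  rw [Nat.le_floor_iff (Real.sqrt_nonneg _), Real.le_sqrt (Nat.cast_nonneg j) hy, ← sub_le_iff_le_add', le_div_iff₀ hH]

/-- The same cut read with the natural-number casts of abc-iut-rp-d2's root form (`jsq_root_window`: `((j² : ℕ) − 1)·H ≤ (2l : ℕ)·κ`). [folklore] -/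
theorem natCast_jsq_sub_one_mul_le_iff_le_floor_sqrt {H κ : ℝ} (hH : 0 < H) (hκ : 0 ≤ κ) (l j : ℕ) :
    (((j ^ 2 : ℕ) : ℝ) - 1) * H ≤ ((2 * l : ℕ) : ℝ) * κ ↔ j ≤ ⌊Real.sqrt (1 + 2 * (l : ℝ) * κ / H)⌋₊ := by
  rw [← jsq_sub_one_mul_le_iff_le_floor_sqrt hH hκ l j]
  push_cast
  exact Iff.rfl

/-- **The cut is MONOTONE in the shell exponent**: `κ ≤ κ'` ⟹ `⌊√(1 + 2lκ/H)⌋₊ ≤ ⌊√(1 + 2lκ'/H)⌋₊` (`H > 0`). [folklore] -/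
theorem floor_sqrt_mono_kappa {H κ κ' : ℝ} (hH : 0 < H) (hκκ' : κ ≤ κ') (l : ℕ) :
    ⌊Real.sqrt (1 + 2 * (l : ℝ) * κ / H)⌋₊ ≤ ⌊Real.sqrt (1 + 2 * (l : ℝ) * κ' / H)⌋₊ := by
  apply Nat.floor_mono
  apply Real.sqrt_le_sqrt
  have hl : (0 : ℝ) ≤ 2 * (l : ℝ) := by positivity
  have := mul_le_mul_of_nonneg_left hκκ' hl
  have := div_le_div_of_nonneg_right this hH.le
  linarith

/-- **The cut is ANTITONE in the local height**: `0 < H ≤ H'`, `0 ≤ κ` ⟹ `⌊√(1 + 2lκ/H')⌋₊ ≤ ⌊√(1 + 2lκ/H)⌋₊`. [folklore] -/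
theorem floor_sqrt_anti_height {H H' κ : ℝ} (hH : 0 < H) (hHH' : H ≤ H') (hκ : 0 ≤ κ) (l : ℕ) :
    ⌊Real.sqrt (1 + 2 * (l : ℝ) * κ / H')⌋₊ ≤ ⌊Real.sqrt (1 + 2 * (l : ℝ) * κ / H)⌋₊ := by
  apply Nat.floor_mono
  apply Real.sqrt_le_sqrt
  have hnum : (0 : ℝ) ≤ 2 * (l : ℝ) * κ := by positivity
  have := div_le_div_of_nonneg_left hnum hH hHH'
  linarith

/-- `j = 1` is below every cut (`κ ≥ 0`, `H > 0`): the label `1` never binds. [folklore] -/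
theorem one_le_floor_sqrt {H κ : ℝ} (hH : 0 < H) (hκ : 0 ≤ κ) (l : ℕ) : 1 ≤ ⌊Real.sqrt (1 + 2 * (l : ℝ) * κ / H)⌋₊ := by
  rw [← jsq_sub_one_mul_le_iff_le_floor_sqrt hH hκ l 1]
  have : (0 : ℝ) ≤ 2 * (l : ℝ) * κ := by positivity
  simpa using this

/-- `a_e ≤ 1` for odd `p` and `e ≥ 1` (`⌈e/(p−2)⌉ ≤ e` since `p − 2 ≥ 1`). [claim: Mochizuki2012, status: disputed] -/
theorem logRadiusA_le_one {p e : ℕ} (hp : 2 < p) (he : 1 ≤ e) : logRadiusA p e ≤ 1 := by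
  have hp2 : (1 : ℝ) ≤ (p : ℝ) - 2 := by
    have : (3 : ℝ) ≤ p := by exact_mod_cast hp
    linarith
  have he0 : (0 : ℝ) < e := by exact_mod_cast he
  rw [logRadiusA, if_neg (by omega), div_le_one he0]
  have hceil : ⌈(e : ℝ) / ((p : ℝ) - 2)⌉ ≤ (e : ℤ) := Int.ceil_le.2 (by
    rw [Int.cast_natCast]
    exact div_le_self he0.le hp2)
  exact_mod_cast hceil

/-- **The sufficient shell exponent is nonnegative at every prime**: `0 ≤ c − a_e` (`c = ord_p(p*)`; `p = 2`: `2 − 2`; odd `p`: `1 − a_e ≥ 0`).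
[cite: MochizukiAbsTopIII2015, Def 5.4 (iii) p. 126] [claim: Mochizuki2012, status: disputed] -/
theorem lowerEdge_nonneg {p e : ℕ} (hp : p.Prime) (he : 1 ≤ e) : 0 ≤ ((if p = 2 then 2 else 1 : ℕ) : ℝ) - logRadiusA p e := by
  by_cases h2 : p = 2
  · subst h2
    rw [CandInternal2RealStrata.lowerEdge_two]
  · have hp2 : 2 < p := lt_of_le_of_ne hp.two_le (Ne.symm h2)
    rw [CandInternal2RealStrata.pstarExp_of_ne_two h2]
    have := logRadiusA_le_one hp2 he
    linarith

/-- **THE TWO CUTS ARE NESTED**: `⌊√(1 + 2l(c − a_e)/H)⌋₊ ≤ ⌊√(1 + 2l(b_e + c)/H)⌋₊` whenever `c − a_e ≤ b_e + c` (i.e. `−a_e ≤ b_e`, which holds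
at every inhabited shell: both radii enclose `ℐ_K`). [folklore] -/
theorem lowerCut_le_upperCut (p : ℕ) {H : ℝ} (hH : 0 < H) (l e : ℕ)
    (hab : ((if p = 2 then 2 else 1 : ℕ) : ℝ) - logRadiusA p e ≤ logRadiusB p e + ((if p = 2 then 2 else 1 : ℕ) : ℝ)) :
    ⌊Real.sqrt (1 + 2 * (l : ℝ) * (((if p = 2 then 2 else 1 : ℕ) : ℝ) - logRadiusA p e) / H)⌋₊ ≤
      ⌊Real.sqrt (1 + 2 * (l : ℝ) * (logRadiusB p e + ((if p = 2 then 2 else 1 : ℕ) : ℝ)) / H)⌋₊ :=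
  floor_sqrt_mono_kappa hH hab l

end Arithmetic

/-! ## §5. The below-cut cells are DECIDED at a genuine local field (abc-iut-rp-d2's root-form window, p450037) -/

section Genuine

variable (p : ℕ) [Fact p.Prime]
variable (K : Type*) [NontriviallyNormedField K] [NormedAlgebra ℚ_[p] K] [IsUltrametricDist K] [ProperSpace K]

/-- **BELOW THE SUFFICIENT CUT EVERY I06⋆ CELL HOLDS** at the real log-shell `ℐ_K = (p*)⁻¹·log_p(𝒪_K^×)` of a local field `K ⊇ ℚ_p`: for `q̲ ≠ 0`
with `‖q̲‖^{2l} = p^{−H}`, `H > 0`, and every label `j ≤ ⌊√(1 + 2l·(c − a_e)/H)⌋₊`: `q̲ ∈ q̲^{j²} · ℐ_K` (abc-iut-rp-d2's `jsq_root_window`, sufficient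
leg, with §4). [cite: MochizukiAbsTopIII2015, Def 5.4 (iii) p. 126] [claim: Mochizuki2012, status: disputed] -/
theorem mem_pow_smul_logShell_of_le_labelCut {q : K} (hq : q ≠ 0) {l : ℕ} (hl : 0 < l) {H : ℝ} (hH : 0 < H)
    (hqN : ‖q‖ ^ (2 * l) = (p : ℝ) ^ (-H)) :
    ∀ j ≤ ⌊Real.sqrt (1 + 2 * (l : ℝ) *
        (((if p = 2 then 2 else 1 : ℕ) : ℝ) - logRadiusA p (absRamificationIdx p K)) / H)⌋₊,
      q ∈ q ^ (j ^ 2) • logShell (PadicLogOnUnits.ofUnitLog p K) := by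
  intro j hj
  have hκ := lowerEdge_nonneg (e := absRamificationIdx p K) (Fact.out : p.Prime) (absRamificationIdx_pos p K)
  exact (jsq_root_window p K hq hl hqN j).1 ((natCast_jsq_sub_one_mul_le_iff_le_floor_sqrt hH hκ l j).2 hj)

/-- **EVERY LABEL AT WHICH I06⋆ HOLDS LIES BELOW THE NECESSARY CUT**: `q̲ ∈ q̲^{j²} · ℐ_K ⟹ j ≤ ⌊√(1 + 2l·(b_e + c)/H)⌋₊` (`H > 0`,
`0 ≤ b_e + c` — else NO label `j ≥ 1` holds; abc-iut-rp-d2's `jsq_root_window`, necessary leg, with §4). [claim: Mochizuki2012, status: disputed] -/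
theorem le_upperCut_of_mem_pow_smul_logShell {q : K} (hq : q ≠ 0) {l : ℕ} (hl : 0 < l) {H : ℝ} (hH : 0 < H)
    (hqN : ‖q‖ ^ (2 * l) = (p : ℝ) ^ (-H))
    (hκ : 0 ≤ logRadiusB p (absRamificationIdx p K) + ((if p = 2 then 2 else 1 : ℕ) : ℝ)) {j : ℕ}
    (hmem : q ∈ q ^ (j ^ 2) • logShell (PadicLogOnUnits.ofUnitLog p K)) :
    j ≤ ⌊Real.sqrt (1 + 2 * (l : ℝ) *
        (logRadiusB p (absRamificationIdx p K) + ((if p = 2 then 2 else 1 : ℕ) : ℝ)) / H)⌋₊ :=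
  (natCast_jsq_sub_one_mul_le_iff_le_floor_sqrt hH hκ l j).1 ((jsq_root_window p K hq hl hqN j).2 hmem)

end Genuine

end Summit.ABC.IUTFork.Repair.CandInternal11GapLabelCutArith

end
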